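import Summits.KontsevichZagierPeriods.KontsevichZagierPeriods.Theorems.HurwitzMicroSectorsNormalFormPrincipleM3EbdExistsSimplexReps

/-!
# `NormalFormPrinciple` (stmt-KontsevichZagierPeriods-3869), line `SketchIdeator1` —
# leaf `stub_boxRigidity`, layer L2W3 (level-2 weight-3 descent): the partial dilation of the prism

Pure proof file (stub `l2w3_prism_dilation_move` of the layer `L2W3`, lead seat c9; `--supports`
the crux). In the level-2 weight-3 descent the weight-2 distribution relation (`Li₂(1)` versus
`Li₂(±1)`) is needed multiplied by the interval factor `∫₀¹ dt/(1+t) = log 2`; inside the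
Kontsevich–Zagier calculus this is ONE change-of-variables move (rule (2)) on the open prism

  `P = {t | 0 < t₁ < t₀ < 1} × {0 < t₂ < 1} ⊆ ℝ³`

along the *partial dilation*

  `Φ(t₀, t₁, t₂) = (t₀², t₁², t₂)`, `DΦ(t) = diag(2t₀, 2t₁, 1)`, `|det DΦ| = 4 t₀ t₁`,

a `ℚ`-polynomial (hence `ℚ`-semialgebraic) map, injective on `P` (squares of positive reals) and
ONTO `P` (squaring preserves the order of positive reals; inverse `(√u₀, √u₁, u₂)`). For an
arbitrary product integrand `x(t₀) y(t₁) z(t₂)` of a GIVEN representation `T` on `P` the pulled-back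
integrand is `(x(s₀²)·2s₀)(y(s₁²)·2s₁)·z(s₂) = (x y z)(Φ s) · |det DΦ(s)|`, so that
`[N] − [T] ∈ KZ.changeOfVariablesRel ⊆ KZ.relations` for every representation `N` on `P` carrying
the pulled-back integrand (part (1)); and such an `N` EXISTS (part (2)): `P` is cut out by strict
`ℚ`-polynomial inequalities, the pulled-back integrand is the composite of the `ℚ`-semialgebraic
function `T.integrand` with the `ℚ`-semialgebraic chart `Φ` (`Φ(P) ⊆ P = T.domain`) times the
polynomial Jacobian, and absolute convergence on `P` is transported from `T` along `Φ` by Mathlib's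
Jacobian criterion `MeasureTheory.integrableOn_image_iff_integrableOn_abs_det_fderiv_smul`
(`Φ '' P = P`). Nothing is assumed about the letters `x, y, z : ℝ → ℝ` beyond what `T` provides.

References: M. Kontsevich, D. Zagier, *Periods* (2001), §1.1–1.2 (rule (2)). No definitions are
introduced.
-/

noncomputable section

open MeasureTheory Set
open Literature.NumberTheory.Transcendental Literature.NumberTheory.Transcendental.KZ
open Literature.ModelTheory.ExponentialFields (IsSemialgebraic)

namespace Summit.KontsevichZagierPeriods.HurwitzMicroSectors.NormalFormPrinciple.PiBox.M3

/-! ## The open prism `P = {0 < t₁ < t₀ < 1} × {0 < t₂ < 1}` -/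

/-- **The open prism `{0 < t₁ < t₀ < 1, 0 < t₂ < 1}` is `ℚ`-semialgebraic**: an intersection of
five strict `ℚ`-polynomial inequalities. [cite: KontsevichZagier2001, §1.1] -/
theorem l2q_isSemialgebraic_prism :
    IsSemialgebraic ℚ {t : Fin 3 → ℝ | 0 < t 1 ∧ t 1 < t 0 ∧ t 0 < 1 ∧ 0 < t 2 ∧ t 2 < 1} := by
  -- adapted from `wdt1_isSemialgebraic_wedge` (…M3WdtBoxSubWedge)
  have h1 := Literature.ModelTheory.ExponentialFields.isSemialgebraic_setOf_eval_lt (k := ℚ)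
    (R := ℝ) (0 : MvPolynomial (Fin 3) ℚ) (MvPolynomial.X 1)
  have h2 := Literature.ModelTheory.ExponentialFields.isSemialgebraic_setOf_eval_lt (k := ℚ)
    (R := ℝ) (MvPolynomial.X 1 : MvPolynomial (Fin 3) ℚ) (MvPolynomial.X 0)
  have h3 := Literature.ModelTheory.ExponentialFields.isSemialgebraic_setOf_eval_lt (k := ℚ)
    (R := ℝ) (MvPolynomial.X 0 : MvPolynomial (Fin 3) ℚ) 1
  have h4 := Literature.ModelTheory.ExponentialFields.isSemialgebraic_setOf_eval_lt (k := ℚ)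
    (R := ℝ) (0 : MvPolynomial (Fin 3) ℚ) (MvPolynomial.X 2)
  have h5 := Literature.ModelTheory.ExponentialFields.isSemialgebraic_setOf_eval_lt (k := ℚ)
    (R := ℝ) (MvPolynomial.X 2 : MvPolynomial (Fin 3) ℚ) 1
  simp only [MvPolynomial.aeval_X, map_zero, map_one] at h1 h2 h3 h4 h5
  have hP : {t : Fin 3 → ℝ | 0 < t 1 ∧ t 1 < t 0 ∧ t 0 < 1 ∧ 0 < t 2 ∧ t 2 < 1} =
      {t : Fin 3 → ℝ | 0 < t 1} ∩ {t | t 1 < t 0} ∩ {t | t 0 < 1} ∩ {t | 0 < t 2} ∩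
        {t | t 2 < 1} := by
    ext t
    simp only [mem_setOf_eq, mem_inter_iff, and_assoc]
  rw [hP]
  exact (((h1.inter h2).inter h3).inter h4).inter h5

/-! ## The partial dilation chart -/

/-- **The partial dilation `Φ(t₀,t₁,t₂) = (t₀², t₁², t₂)`** of the open prism
`P = {0 < t₁ < t₀ < 1} × {0 < t₂ < 1}`: a `ℚ`-polynomial (hence `ℚ`-semialgebraic) map,
differentiable with derivative `diag(2t₀, 2t₁, 1)` and `|det DΦ| = 4 t₀ t₁` on `P`, injective on
`P` (squares of positive reals) and ONTO `P` (squaring preserves the order of positive reals;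
inverse `(√u₀, √u₁, u₂)`). [folklore] -/
theorem l2q_exists_prismDilationChart :
    ∃ (Φ : (Fin 3 → ℝ) → (Fin 3 → ℝ)) (Φ' : (Fin 3 → ℝ) → (Fin 3 → ℝ) →L[ℝ] (Fin 3 → ℝ)),
      (∀ t, Φ t 0 = t 0 ^ 2) ∧ (∀ t, Φ t 1 = t 1 ^ 2) ∧ (∀ t, Φ t 2 = t 2) ∧
      IsSemialgebraicMapOn ℚ
        {t : Fin 3 → ℝ | 0 < t 1 ∧ t 1 < t 0 ∧ t 0 < 1 ∧ 0 < t 2 ∧ t 2 < 1} Φ ∧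
      (∀ t, HasFDerivAt Φ (Φ' t) t) ∧
      Set.InjOn Φ {t : Fin 3 → ℝ | 0 < t 1 ∧ t 1 < t 0 ∧ t 0 < 1 ∧ 0 < t 2 ∧ t 2 < 1} ∧
      Φ '' {t : Fin 3 → ℝ | 0 < t 1 ∧ t 1 < t 0 ∧ t 0 < 1 ∧ 0 < t 2 ∧ t 2 < 1} =
        {t : Fin 3 → ℝ | 0 < t 1 ∧ t 1 < t 0 ∧ t 0 < 1 ∧ 0 < t 2 ∧ t 2 < 1} ∧
      (∀ t ∈ {t : Fin 3 → ℝ | 0 < t 1 ∧ t 1 < t 0 ∧ t 0 < 1 ∧ 0 < t 2 ∧ t 2 < 1},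
        |(Φ' t).det| = 4 * t 0 * t 1) := by
  -- adapted from `lt2_exists_squaresChart` (…LevelTwoSquares) and `wdt1_exists_wedgeChart`
  set Φ : (Fin 3 → ℝ) → (Fin 3 → ℝ) := fun t => ![t 0 ^ 2, t 1 ^ 2, t 2]
  set Φ' : (Fin 3 → ℝ) → (Fin 3 → ℝ) →L[ℝ] (Fin 3 → ℝ) := fun t =>
    LinearMap.toContinuousLinearMap (Matrix.toLin' !![2 * t 0, 0, 0; 0, 2 * t 1, 0; 0, 0, 1])
  have hΦ0 : ∀ t, Φ t 0 = t 0 ^ 2 := fun t => rfl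
  have hΦ1 : ∀ t, Φ t 1 = t 1 ^ 2 := fun t => rfl
  have hΦ2 : ∀ t, Φ t 2 = t 2 := fun t => rfl
  have hΦ'0 : ∀ t v : Fin 3 → ℝ, Φ' t v 0 = 2 * t 0 * v 0 := by
    intro t v
    change Matrix.toLin' !![2 * t 0, 0, 0; 0, 2 * t 1, 0; 0, 0, 1] v 0 = _
    rw [Matrix.toLin'_apply]
    simp [Matrix.mulVec, dotProduct, Fin.sum_univ_three]
  have hΦ'1 : ∀ t v : Fin 3 → ℝ, Φ' t v 1 = 2 * t 1 * v 1 := by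
    intro t v
    change Matrix.toLin' !![2 * t 0, 0, 0; 0, 2 * t 1, 0; 0, 0, 1] v 1 = _
    rw [Matrix.toLin'_apply]
    simp [Matrix.mulVec, dotProduct, Fin.sum_univ_three]
  have hΦ'2 : ∀ t v : Fin 3 → ℝ, Φ' t v 2 = v 2 := by
    intro t v
    change Matrix.toLin' !![2 * t 0, 0, 0; 0, 2 * t 1, 0; 0, 0, 1] v 2 = _
    rw [Matrix.toLin'_apply]
    simp [Matrix.mulVec, dotProduct, Fin.sum_univ_three]
  have hdet : ∀ t, (Φ' t).det = 4 * t 0 * t 1 := by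
    intro t
    change LinearMap.det (Matrix.toLin' !![2 * t 0, 0, 0; 0, 2 * t 1, 0; 0, 0, 1]) = _
    rw [LinearMap.det_toLin', Matrix.det_fin_three]
    simp only [Matrix.of_apply, Matrix.cons_val', Matrix.cons_val_zero, Matrix.cons_val_one,
      Matrix.cons_val_two, Matrix.cons_val_fin_one, Matrix.head_cons, Matrix.tail_cons,
      Matrix.empty_val', Matrix.head_fin_const]
    ring
  have hderiv : ∀ t, HasFDerivAt Φ (Φ' t) t := by
    intro t
    have h0 : HasFDerivAt (fun w : Fin 3 → ℝ => w 0)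
        (ContinuousLinearMap.proj (R := ℝ) (φ := fun _ : Fin 3 => ℝ) 0) t := hasFDerivAt_apply 0 t
    have h1 : HasFDerivAt (fun w : Fin 3 → ℝ => w 1)
        (ContinuousLinearMap.proj (R := ℝ) (φ := fun _ : Fin 3 => ℝ) 1) t := hasFDerivAt_apply 1 t
    have h2 : HasFDerivAt (fun w : Fin 3 → ℝ => w 2)
        (ContinuousLinearMap.proj (R := ℝ) (φ := fun _ : Fin 3 => ℝ) 2) t := hasFDerivAt_apply 2 t
    have c0 : HasFDerivAt (fun w : Fin 3 → ℝ => Φ w 0)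
        ((ContinuousLinearMap.proj 0).comp (Φ' t)) t := by
      have hf : (fun w : Fin 3 → ℝ => Φ w 0) = fun w => w 0 * w 0 :=
        funext fun w => by rw [hΦ0, sq]
      rw [hf]
      refine (h0.mul h0).congr_fderiv (ContinuousLinearMap.ext fun v => ?_)
      simp [hΦ'0]
      ring
    have c1 : HasFDerivAt (fun w : Fin 3 → ℝ => Φ w 1)
        ((ContinuousLinearMap.proj 1).comp (Φ' t)) t := by
      have hf : (fun w : Fin 3 → ℝ => Φ w 1) = fun w => w 1 * w 1 :=
        funext fun w => by rw [hΦ1, sq]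
      rw [hf]
      refine (h1.mul h1).congr_fderiv (ContinuousLinearMap.ext fun v => ?_)
      simp [hΦ'1]
      ring
    have c2 : HasFDerivAt (fun w : Fin 3 → ℝ => Φ w 2)
        ((ContinuousLinearMap.proj 2).comp (Φ' t)) t := by
      have hf : (fun w : Fin 3 → ℝ => Φ w 2) = fun w => w 2 := funext fun w => hΦ2 w
      rw [hf]
      refine h2.congr_fderiv (ContinuousLinearMap.ext fun v => ?_)
      simp [hΦ'2]
    rw [hasFDerivAt_pi']
    intro i
    fin_cases i
    · exact c0
    · exact c1
    · exact c2
  refine ⟨Φ, Φ', hΦ0, hΦ1, hΦ2, ?_, hderiv, ?_, ?_, fun t ht => ?_⟩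
  · -- a `ℚ`-polynomial map is `ℚ`-semialgebraic
    convert isSemialgebraicMapOn_aeval l2q_isSemialgebraic_prism
      ![MvPolynomial.X 0 ^ 2, MvPolynomial.X 1 ^ 2,
        (MvPolynomial.X 2 : MvPolynomial (Fin 3) ℚ)] using 2 with t
    funext i
    fin_cases i
    · simp [hΦ0]
    · simp [hΦ1]
    · simp [hΦ2]
  · -- injective on the prism (squares of positive reals)
    intro s hs t ht hst
    have e0 : s 0 ^ 2 = t 0 ^ 2 := by rw [← hΦ0, ← hΦ0, hst]
    have e1 : s 1 ^ 2 = t 1 ^ 2 := by rw [← hΦ1, ← hΦ1, hst]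
    have e2 : s 2 = t 2 := (hΦ2 s).symm.trans ((congrFun hst 2).trans (hΦ2 t))
    have f0 : s 0 = t 0 :=
      (pow_left_inj₀ (hs.1.trans hs.2.1).le (ht.1.trans ht.2.1).le two_ne_zero).1 e0
    have f1 : s 1 = t 1 := (pow_left_inj₀ hs.1.le ht.1.le two_ne_zero).1 e1
    funext i
    fin_cases i
    · exact f0
    · exact f1
    · exact e2
  · -- onto the prism
    ext u
    constructor
    · rintro ⟨t, ⟨h1, h10, h0, h2, h21⟩, rfl⟩
      rw [mem_setOf_eq, hΦ0, hΦ1, hΦ2]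
      exact ⟨pow_pos h1 2, pow_lt_pow_left₀ h10 h1.le two_ne_zero,
        pow_lt_one₀ (h1.trans h10).le h0 two_ne_zero, h2, h21⟩
    · rintro ⟨h1, h10, h0, h2, h21⟩
      have hu0 : 0 < u 0 := h1.trans h10
      have hs0 : Real.sqrt (u 0) < 1 := by
        have h := Real.sqrt_lt_sqrt hu0.le h0
        rwa [Real.sqrt_one] at h
      refine ⟨![Real.sqrt (u 0), Real.sqrt (u 1), u 2], ?_, ?_⟩
      · show 0 < Real.sqrt (u 1) ∧ Real.sqrt (u 1) < Real.sqrt (u 0) ∧ Real.sqrt (u 0) < 1 ∧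
          0 < u 2 ∧ u 2 < 1
        exact ⟨Real.sqrt_pos.2 h1, Real.sqrt_lt_sqrt h1.le h10, hs0, h2, h21⟩
      · funext i
        fin_cases i
        · change Real.sqrt (u 0) ^ 2 = u 0
          exact Real.sq_sqrt hu0.le
        · change Real.sqrt (u 1) ^ 2 = u 1
          exact Real.sq_sqrt h1.le
        · rfl
  · -- the Jacobian
    rw [hdet, abs_of_pos (mul_pos (mul_pos four_pos (ht.1.trans ht.2.1)) ht.1)]

/-! ## The registered sub-goal -/

/-- **Stub L7 (the partial dilation `(t₀, t₁, t₂) ↦ (t₀², t₁², t₂)` of the prism, rule (2);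
registered sub-goal `l2w3_prism_dilation_move` of stmt-KontsevichZagierPeriods-3869, line
`SketchIdeator1`, layer L2W3).** Let `T` be a representation on the open prism
`P = {0 < t₁ < t₀ < 1} × {0 < t₂ < 1}` whose integrand agrees with `x(t₀) y(t₁) z(t₂)` on `P`, for
arbitrary letters `x, y, z : ℝ → ℝ`. (1) For every representation `N` on `P` whose integrand agrees
with the pulled-back integrand `(x(s₀²)·2s₀)(y(s₁²)·2s₁)·z(s₂)` on `P`, `[N] − [T]` is ONE
change-of-variables move of the Kontsevich–Zagier calculus along the partial dilation
`Φ(s) = (s₀², s₁², s₂)` of `P` onto itself (`l2q_exists_prismDilationChart`, `|det DΦ| = 4s₀s₁`).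
(2) Such an `N` exists: `P` is `ℚ`-semialgebraic (`l2q_isSemialgebraic_prism`), the pulled-back
integrand is `(T.integrand ∘ Φ) · 4s₀s₁` on `P`, a `ℚ`-semialgebraic function
(`IsSemialgebraicFunOn.comp_isSemialgebraicMapOn_holds`, `IsSemialgebraicFunOn.mul_holds`), and its
absolute convergence on `P = Φ(P)` is that of `T` transported along `Φ`
(`MeasureTheory.integrableOn_image_iff_integrableOn_abs_det_fderiv_smul`).
[cite: KontsevichZagier2001, §1.2 rule (2)] -/
theorem l2w3_prism_dilation_move :
    ∀ (x y z : ℝ → ℝ) (T : IntegralRep 3),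
      T.domain = {t | 0 < t 1 ∧ t 1 < t 0 ∧ t 0 < 1 ∧ 0 < t 2 ∧ t 2 < 1} →
      EqOn T.integrand (fun t => x (t 0) * y (t 1) * z (t 2)) T.domain →
      (∀ N : IntegralRep 3, N.domain = {t | 0 < t 1 ∧ t 1 < t 0 ∧ t 0 < 1 ∧ 0 < t 2 ∧ t 2 < 1} →
        EqOn N.integrand (fun s => (x (s 0 ^ 2) * (2 * s 0)) * (y (s 1 ^ 2) * (2 * s 1)) * z (s 2))
          N.domain →
        of N - of T ∈ relations) ∧
      (∃ N : IntegralRep 3, N.domain = {t | 0 < t 1 ∧ t 1 < t 0 ∧ t 0 < 1 ∧ 0 < t 2 ∧ t 2 < 1} ∧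
        N.integrand = fun s => (x (s 0 ^ 2) * (2 * s 0)) * (y (s 1 ^ 2) * (2 * s 1)) * z (s 2)) := by
  intro x y z T hTd hTi
  obtain ⟨Φ, Φ', hΦ0, hΦ1, hΦ2, hsa, hderiv, hinj, himage, hdet⟩ := l2q_exists_prismDilationChart
  have hσ := l2q_isSemialgebraic_prism
  have hS : MeasurableSet {t : Fin 3 → ℝ | 0 < t 1 ∧ t 1 < t 0 ∧ t 0 < 1 ∧ 0 < t 2 ∧ t 2 < 1} :=
    hσ.measurableSet_holds
  -- the chart maps the prism into itself, i.e. into `T.domain`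
  have hmaps : MapsTo Φ {t : Fin 3 → ℝ | 0 < t 1 ∧ t 1 < t 0 ∧ t 0 < 1 ∧ 0 < t 2 ∧ t 2 < 1}
      {t : Fin 3 → ℝ | 0 < t 1 ∧ t 1 < t 0 ∧ t 0 < 1 ∧ 0 < t 2 ∧ t 2 < 1} := by
    intro t ht
    rw [← himage]
    exact mem_image_of_mem Φ ht
  have hTi' : ∀ t ∈ {t : Fin 3 → ℝ | 0 < t 1 ∧ t 1 < t 0 ∧ t 0 < 1 ∧ 0 < t 2 ∧ t 2 < 1},
      T.integrand t = x (t 0) * y (t 1) * z (t 2) := by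
    intro t ht
    rw [← hTd] at ht
    exact hTi ht
  -- the pull-back identity on the prism, Jacobian `|det DΦ| = 4 s₀ s₁` included
  have hpull : ∀ s ∈ {t : Fin 3 → ℝ | 0 < t 1 ∧ t 1 < t 0 ∧ t 0 < 1 ∧ 0 < t 2 ∧ t 2 < 1},
      (x (s 0 ^ 2) * (2 * s 0)) * (y (s 1 ^ 2) * (2 * s 1)) * z (s 2) =
        T.integrand (Φ s) * |(Φ' s).det| := by
    intro s hs
    rw [hTi' (Φ s) (hmaps hs), hΦ0, hΦ1, hΦ2, hdet s hs]
    ring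
  refine ⟨fun N hNd hNi => ?_, ?_⟩
  · -- part (1): ONE rule-(2) move along the partial dilation
    have himage' : T.domain = Φ '' N.domain := by rw [hNd, himage, hTd]
    have hsa' : IsSemialgebraicMapOn ℚ N.domain Φ := by rw [hNd]; exact hsa
    have hinj' : InjOn Φ N.domain := by rw [hNd]; exact hinj
    refine changeOfVariablesRel_subset_relations
      ⟨3, N, T, Φ, Φ', hsa', fun s _ => (hderiv s).hasFDerivWithinAt, hinj', himage',
        fun s hs => ?_, rfl⟩
    have hs' : s ∈ {t : Fin 3 → ℝ | 0 < t 1 ∧ t 1 < t 0 ∧ t 0 < 1 ∧ 0 < t 2 ∧ t 2 < 1} := by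
      rw [← hNd]
      exact hs
    rw [hNi hs]
    exact hpull s hs'
  · -- part (2): the pulled-back representation exists
    -- semialgebraicity: `(T.integrand ∘ Φ) · (4 s₀ s₁)` agrees with the integrand on the prism
    have hTσ : IsSemialgebraicFunOn ℚ
        {t : Fin 3 → ℝ | 0 < t 1 ∧ t 1 < t 0 ∧ t 0 < 1 ∧ 0 < t 2 ∧ t 2 < 1} T.integrand := by
      rw [← hTd]
      exact T.isSemialgebraicFunOn_integrand
    have hcomp : IsSemialgebraicFunOn ℚ
        {t : Fin 3 → ℝ | 0 < t 1 ∧ t 1 < t 0 ∧ t 0 < 1 ∧ 0 < t 2 ∧ t 2 < 1} (T.integrand ∘ Φ) :=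
      IsSemialgebraicFunOn.comp_isSemialgebraicMapOn_holds hTσ hsa hmaps
    have hjac : IsSemialgebraicFunOn ℚ
        {t : Fin 3 → ℝ | 0 < t 1 ∧ t 1 < t 0 ∧ t 0 < 1 ∧ 0 < t 2 ∧ t 2 < 1}
        (fun s => MvPolynomial.aeval s
          (4 * MvPolynomial.X 0 * MvPolynomial.X 1 : MvPolynomial (Fin 3) ℚ)) :=
      isSemialgebraicFunOn_aeval hσ _
    have hNσ : IsSemialgebraicFunOn ℚ
        {t : Fin 3 → ℝ | 0 < t 1 ∧ t 1 < t 0 ∧ t 0 < 1 ∧ 0 < t 2 ∧ t 2 < 1}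
        (fun s => (x (s 0 ^ 2) * (2 * s 0)) * (y (s 1 ^ 2) * (2 * s 1)) * z (s 2)) := by
      refine (IsSemialgebraicFunOn.mul_holds hcomp hjac).congr fun s hs => ?_
      simp only [Pi.mul_apply, Function.comp_apply, map_mul, map_ofNat, MvPolynomial.aeval_X]
      rw [hpull s hs, hdet s hs]
    -- integrability: transported from `T` along `Φ` (`Φ '' P = P = T.domain`)
    have hTint : IntegrableOn T.integrand
        (Φ '' {t : Fin 3 → ℝ | 0 < t 1 ∧ t 1 < t 0 ∧ t 0 < 1 ∧ 0 < t 2 ∧ t 2 < 1}) := by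
      rw [himage, ← hTd]
      exact T.integrableOn
    have hint : IntegrableOn
        (fun s : Fin 3 → ℝ => (x (s 0 ^ 2) * (2 * s 0)) * (y (s 1 ^ 2) * (2 * s 1)) * z (s 2))
        {t : Fin 3 → ℝ | 0 < t 1 ∧ t 1 < t 0 ∧ t 0 < 1 ∧ 0 < t 2 ∧ t 2 < 1} := by
      have h := (integrableOn_image_iff_integrableOn_abs_det_fderiv_smul volume hS
        (fun s _ => (hderiv s).hasFDerivWithinAt) hinj T.integrand).1 hTint
      refine h.congr_fun (fun s hs => ?_) hS
      show |(Φ' s).det| • T.integrand (Φ s) =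
        (x (s 0 ^ 2) * (2 * s 0)) * (y (s 1 ^ 2) * (2 * s 1)) * z (s 2)
      rw [smul_eq_mul, mul_comm]
      exact (hpull s hs).symm
    exact ⟨⟨_, _, hσ, hNσ, hint⟩, rfl, rfl⟩

end Summit.KontsevichZagierPeriods.HurwitzMicroSectors.NormalFormPrinciple.PiBox.M3
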